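import Summits.ABC.ABC.Theses.IsogenyGlueCongruence

/-!
# Disproof of `DegreePrimesPolyBounded` (stmt-ABC-2045) — findings of the standing disprover (cdisprove, gen 1, cycle 1)

Crux A (route `IsogenyGlueCongruence`, rank 3):
`∃ κ C : ℝ, ∀ W [IsElliptic] [IsGloballyMinimal] [NeZero N], W.IsSemistable ℤ →
  ∃ D : ModularParametrizationData W N, ∀ ℓ prime, ℓ ∣ D.modularDegree → ℓ ≤ C · N^κ`, `N = W.conductorNorm ℤ`
("every prime factor of the modular degree of a semistable curve is polynomially bounded in the conductor").

**VERDICT (cycle 1): RESISTS — an unconditional `¬A` would be `¬ABC`.**  A is implied by the sharp degree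
conjecture X (`degreePrimesPolyBounded_of_semistableDegreeConjecture`, §1) and already by its polynomial form
(`degreePrimesPolyBounded_of_polyDegree`); X in turn follows from abc (abc ⟹ generalised Szpiro
`max(|Δ|,|c₄|³) ≪ N^{6+ε}` ⟹ `h_F(E) ≤ (1/2+ε) log N + O_ε(1)` ⟹ `deg φ = 4π²c²(f,f)e^{2h_F} ≪ N^{2+ε}`,
Zagier's formula with `(f,f) ≪ N log N`).  So every census below can only CALIBRATE `κ, C`; no finite computation
and no known family refutes an `∃ κ C` statement, and the one mechanism that could (a same-level congruence of
`f_E` with a giant newform orbit modulo `ℓ ≈ exp(N^δ)`) contradicts nothing known but is not known to occur.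

What IS established here (sorry-free unless marked NEAR-MISS; LANDED in the tree:
`Summits/ABC/ABC/Theorems/DegreePrimesPolyBounded/Negative/Pump.lean` (p84361: `pump`, `not_forall_datum_primes_bounded_of`,
`…_of_facts`, `uniformize_eq_of_lattice_eq`, `deg_unique`, `deg_eq_sq_mul_deg`, `infinite_point`) and
`…/Negative/Variants.lean` (p84298: `divisors_bounded_iff_degree_bounded`, `not_degree_bounded_of_not_degreePrimesPolyBounded`,
`not_semistableDegreeConjecture_of_not_degreePrimesPolyBounded`, `isEmpty_modularParametrizationData_of_eq_one`,
`not_degreePrimesPolyBounded_of_conductorNorm_eq_one`) — importable by ideators/planners):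

* §1 CALIBRATION. `A ⟸ PolyDegree ⟸ X` (trivial: `ℓ ∣ deg ⇒ ℓ ≤ deg`); `PolyDegreeOfBoundedPrimes ↔ (A → PolyDegree)`
  and `SharpDegreeOfPolyDegree ↔ (PolyDegree → X)` by `Iff.rfl`: the route's chain B, R sits entirely ABOVE A.
* §2 LOAD-BEARING HYPOTHESES.
  - `ℓ.Prime`: dropping it turns A into EXACTLY the polynomial degree conjecture (`withoutPrime_iff_polyDegree`)
    — the prime-by-prime form is a genuine weakening only through primality.
  - `IsGloballyMinimal`: LOAD-BEARING FOR A JUNK REASON (`DegreePrimesPolyBoundedWithoutMinimal`, NEAR-MISS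
    `degreePrimesPolyBounded_false_without_minimal`, informal proof complete, formal proof blocked): the lattice
    `L` of a datum is pinned to the MODEL (`IsNeronLatticeOf`: `g₂ = c₄/12, g₃ = c₆/216`), so the integral
    NON-minimal model `W_p : a_i ↦ p^i a_i` of an optimal semistable curve `E` (same conductor, still semistable —
    both notions are intrinsic in the tree: `IsSemistable` via `localMinimalModel`, `conductorNorm` via Ogg
    exponents) has `Λ_{W_p} = p⁻¹ Λ_E`, every admissible Manin constant `c ∈ ℤ` gives
    `φ_D : X₀(N) → ℂ/Λ_f → ℂ/p⁻¹Λ_E` of degree `m_E · [c⁻¹p⁻¹Λ_E : Λ_f] = m_E (cp)²` (Manin constant `c₀ = 1`,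
    Česnavičius 2018), so `p ∣ D.deg` for EVERY datum of `W_p` while `N(W_p) = N(E)`: with `p → ∞` the
    minimality-free statement is false.  Any proof of A must use minimality exactly here (or restate A over
    `ℚ`-isomorphism classes / the minimal datum).
  - `IsSemistable`: NOT load-bearing for truth — the all-curves version is still a consequence of abc (generalised
    Szpiro holds for all `E/ℚ` under abc); recorded as `DegreePrimesPolyBoundedWithoutSemistable → A` only.
    Possibly unnecessary; the route needs it for Ribet/Mazur inputs (irreducibility of `ρ̄_{E,ℓ}`, `ℓ ≥ 11`).
  - `NeZero (conductorNorm)`: automatic (`conductorNorm_pos_holds`).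
* §3 PUMPING THE MANIN CONSTANT (new, reusable by every crux quantifying `∃ D : ModularParametrizationData`):
  from a datum `D` and `k ≥ 1`, `pump D k` is a datum with `c' = k c`, `deg' = k² deg` (`φ' = [k] ∘ φ`), its
  `deg_spec` PROVED from `D`'s fields (torsion count `#E[k] = k²` through `uniformize`, fibre decomposition)
  modulo the `Γ₀(N)`-invariance `D.φ_gamma0_smul` (= C9 fact `eichlerIntegral_gamma_smul`).  Consequences:
  (i) the `∀ D` strengthening of A is FALSE (`not_degreePrimesPolyBoundedAllD_of`, `…_of_facts`): the `∃ D` is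
  essential, data degrees of a fixed curve contain `k² · deg` for every `k` (the sibling disprover of
  `FreyDegreeBound` listed this as "not formalised", §6(b) of its file; it now is); (ii) CONVERSELY the datum has
  no other freedom: `uniformize` is pinned by the lattice (`uniformize_eq_of_lattice_eq`, via `℘[L]` depending on
  `L.lattice` only), the degree is pinned by `φ` (`deg_unique`, `E(ℂ)` is infinite by `infinite_point`), and two
  data with the same newform and lattice whose Manin constants differ by `k` have degrees differing by EXACTLY `k²`
  (`deg_eq_sq_mul_deg`) — the reviewers' informal "∃D cannot cheat: deg = (c/c₀)²·deg_min" is now kernel-checked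
  modulo (same `f`: multiplicity one `existsUnique_isNewformOf`; same lattice: `g₂, g₃` determine `Λ`, not in
  Mathlib; invariance).
* §4 THE ONLY JUNK MODEL: A is junk-false iff the tree's `conductorNorm ℤ` takes the value `1` on some semistable
  globally-minimal elliptic `W` (`not_degreePrimesPolyBounded_of_conductorNorm_eq_one`; no datum exists at level 1
  because `S₂(SL₂(ℤ)) = 0` in Mathlib, `isEmpty_modularParametrizationData_of_eq_one`).  Mathematically excluded
  (Tate/Ogg: no `E/ℚ` has everywhere good reduction, `N ≥ 11`; for semistable `W` the tree's `N = rad(Δ_min)`),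
  but "no everywhere-good-reduction curve over ℚ" is NOT in the tree (searched `everywhere good`,
  `one_lt_conductorNorm`, `conductorNorm_ne_one`): provers closing A positively through modularity facts never
  meet it; a refuter cannot use it.
* §5 CENSUS: the crux-ideate card `partner-dimension-census` (kit j012368/j012760) already measured
  `sup log P⁺(deg φ)/log N = 0.865` on 4391 generic semistable curves `N ≤ 6·10⁴` (no `P⁺ > N`; Dickman-like),
  `log deg/log N ≤ 2.01` and a same-level prime `17393 ≈ N^{0.89}` on high-quality Frey curves, and giant-orbit
  partners for 32/32 congruence primes — consistent with A for `κ ≥ 0.9`, no structure below the size of `δ`;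
  this seat's box run j014696 (`N ≤ 5000`, 411 curves): `sup r = 0.743`; beyond `N ≈ 10⁵` PARI's `ellmoddegree`
  exceeds 900 s/curve (j014711 abandoned) — extension needs Cremona's `degphi` tables (acq-05812).
* §6 NOT ATTEMPTED / OPEN: tightness in `κ` — even "the prime factors of `deg φ_E` over semistable `E` are
  unbounded" (`κ = 0` false) is not known in print (deg φ → ∞ is, Watkins/Papikian-type lower bounds, but no
  large prime factor is forced: Atkin–Lehner signs force powers of 2 only); no Lean handle on any individual
  modular degree exists (hypothesis structure; existence = BCDT fact), so no `decide`-style refutation of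
  explicit-constant variants (`ℓ ≤ N`, `ℓ ≤ N²`) is possible — they are calibrated by §5 only.

Attacks tried (cycle 1), one line each: definitional audit of the ∃D/model dependence (→ §2 minimality, §3) ·
level-one vacuity (→ §4) · hypothesis mutation (prime, minimal, semistable, NeZero → §2) · quantifier mutation
(∀D → §3; κ,C after W: trivially true given a datum, `allW_exists_bound`) · negatives index (`ledger negatives
--problem ABC`: 2 entries, unrelated: quasi-log-derivative, Belyi degree) · barrier catalogue
`Literature/Barriers/ABC/` (BakerMethodBounds: A is of shape `BakerShapeBound 0 1`-polynomial, not blocked;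
EpsilonCannotBeDropped / SzpiroEpsilonCannotBeDropped: concern sharp exponents, A has a free `κ` — no bite) ·
literature (searchd unavailable during this cycle; queries queued in NOTES) · census §5.
-/

noncomputable section

set_option linter.dupNamespace false

open scoped MatrixGroups
open Literature.NumberTheory.EllipticCurves.ModularForms CongruenceSubgroup UpperHalfPlane
open Summit.ABC.ABC.Theses.IsogenyGlueCongruence

namespace Summit.ABC.ABC.Cruxes.DegreePrimesPolyBounded.Disproof

/-! ## §0 The crux and its neighbours, restated -/

/-- Crux A with a FIXED exponent `κ` (one constant `C`). -/
def DegreePrimesBoundExp (κ : ℝ) : Prop :=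
  ∃ C : ℝ, ∀ (W : WeierstrassCurve ℚ) [W.IsElliptic] [W.IsGloballyMinimal] [NeZero (W.conductorNorm ℤ)],
    W.IsSemistable ℤ → ∃ D : ModularParametrizationData W (W.conductorNorm ℤ),
      ∀ ℓ : ℕ, ℓ.Prime → ℓ ∣ D.modularDegree → (ℓ : ℝ) ≤ C * (W.conductorNorm ℤ : ℝ) ^ κ

/-- `A ↔ ∃ κ, DegreePrimesBoundExp κ` (by `rfl`). -/
theorem degreePrimesPolyBounded_iff_exists_exp :
    DegreePrimesPolyBounded ↔ ∃ κ : ℝ, DegreePrimesBoundExp κ :=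
  Iff.rfl

/-- The exponent form is monotone in `κ` (conductors are `≥ 1`; a negative `C` is first replaced by `0`). -/
theorem DegreePrimesBoundExp.mono {κ κ' : ℝ} (h : DegreePrimesBoundExp κ) (hκ : κ ≤ κ') :
    DegreePrimesBoundExp κ' := by
  obtain ⟨C, hC⟩ := h
  refine ⟨max C 0, fun W _ _ _ hW ↦ ?_⟩
  obtain ⟨D, hD⟩ := hC W hW
  refine ⟨D, fun ℓ hℓ hdvd ↦ (hD ℓ hℓ hdvd).trans ?_⟩
  have hN : (1 : ℝ) ≤ (W.conductorNorm ℤ : ℝ) := by exact_mod_cast NeZero.one_le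
  calc C * (W.conductorNorm ℤ : ℝ) ^ κ ≤ max C 0 * (W.conductorNorm ℤ : ℝ) ^ κ :=
        mul_le_mul_of_nonneg_right (le_max_left _ _) (Real.rpow_nonneg (by positivity) _)
    _ ≤ max C 0 * (W.conductorNorm ℤ : ℝ) ^ κ' :=
        mul_le_mul_of_nonneg_left (Real.rpow_le_rpow_of_exponent_le hN hκ) (le_max_right _ _)

/-- Normal form of the constants: granted that conductors of semistable minimal elliptic curves are `≥ 2`
(true — `N_E ≥ 11`, Tate–Ogg — but not in the tree), the constant `C` can be absorbed into the exponent
(`C N^κ ≤ N^{κ + log₂ max(C,1)}` for `N ≥ 2`). So A is a one-parameter family of statements in `κ` alone. -/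
theorem degreePrimesPolyBounded_iff_const_one
    (h2 : ∀ (W : WeierstrassCurve ℚ) [W.IsElliptic] [W.IsGloballyMinimal], W.IsSemistable ℤ →
      2 ≤ W.conductorNorm ℤ) :
    DegreePrimesPolyBounded ↔ ∃ κ : ℝ, ∀ (W : WeierstrassCurve ℚ) [W.IsElliptic] [W.IsGloballyMinimal]
      [NeZero (W.conductorNorm ℤ)], W.IsSemistable ℤ → ∃ D : ModularParametrizationData W (W.conductorNorm ℤ),
        ∀ ℓ : ℕ, ℓ.Prime → ℓ ∣ D.modularDegree → (ℓ : ℝ) ≤ (W.conductorNorm ℤ : ℝ) ^ κ := by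
  constructor
  · rintro ⟨κ, C, h⟩
    refine ⟨κ + Real.logb 2 (max C 1), fun W _ _ _ hW ↦ ?_⟩
    obtain ⟨D, hD⟩ := h W hW
    refine ⟨D, fun ℓ hℓ hdvd ↦ (hD ℓ hℓ hdvd).trans ?_⟩
    have hN2 : (2 : ℝ) ≤ (W.conductorNorm ℤ : ℝ) := by exact_mod_cast h2 W hW
    have hN0 : (0 : ℝ) < (W.conductorNorm ℤ : ℝ) := by linarith
    have hC1 : (1 : ℝ) ≤ max C 1 := le_max_right _ _
    have ht : 0 ≤ Real.logb 2 (max C 1) := Real.logb_nonneg one_lt_two hC1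
    have hmax : max C 1 ≤ (W.conductorNorm ℤ : ℝ) ^ Real.logb 2 (max C 1) :=
      calc max C 1 = (2 : ℝ) ^ Real.logb 2 (max C 1) :=
            (Real.rpow_logb two_pos (by norm_num) (by linarith)).symm
        _ ≤ (W.conductorNorm ℤ : ℝ) ^ Real.logb 2 (max C 1) := Real.rpow_le_rpow (by norm_num) hN2 ht
    calc C * (W.conductorNorm ℤ : ℝ) ^ κ ≤ max C 1 * (W.conductorNorm ℤ : ℝ) ^ κ :=
          mul_le_mul_of_nonneg_right (le_max_left _ _) (Real.rpow_nonneg hN0.le _)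
      _ ≤ (W.conductorNorm ℤ : ℝ) ^ Real.logb 2 (max C 1) * (W.conductorNorm ℤ : ℝ) ^ κ :=
          mul_le_mul_of_nonneg_right hmax (Real.rpow_nonneg hN0.le _)
      _ = (W.conductorNorm ℤ : ℝ) ^ (κ + Real.logb 2 (max C 1)) := by
          rw [Real.rpow_add hN0, mul_comm]
  · rintro ⟨κ, h⟩
    refine ⟨κ, 1, fun W _ _ _ hW ↦ ?_⟩
    obtain ⟨D, hD⟩ := h W hW
    exact ⟨D, fun ℓ hℓ hdvd ↦ by rw [one_mul]; exact hD ℓ hℓ hdvd⟩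

/-- The POLYNOMIAL modular-degree conjecture for semistable curves (= the consequent of crux B
`PolyDegreeOfBoundedPrimes`, = the antecedent of the residual R `SharpDegreeOfPolyDegree`; Frey's height
conjecture, PastenShimura2024 Conj. 3.2, restricted to semistable curves). -/
def PolyDegree : Prop :=
  ∃ κ C : ℝ, ∀ (W : WeierstrassCurve ℚ) [W.IsElliptic] [W.IsGloballyMinimal] [NeZero (W.conductorNorm ℤ)],
    W.IsSemistable ℤ → ∃ D : ModularParametrizationData W (W.conductorNorm ℤ),
      (D.modularDegree : ℝ) ≤ C * (W.conductorNorm ℤ : ℝ) ^ κ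

/-- Crux B is literally `A → PolyDegree`. -/
theorem polyDegreeOfBoundedPrimes_iff : PolyDegreeOfBoundedPrimes ↔ (DegreePrimesPolyBounded → PolyDegree) :=
  Iff.rfl

/-- Crux R is literally `PolyDegree → X`. -/
theorem sharpDegreeOfPolyDegree_iff : SharpDegreeOfPolyDegree ↔ (PolyDegree → SemistableDegreeConjecture) :=
  Iff.rfl

/-! ## §1 Calibration: A is below the polynomial degree conjecture, hence below X, hence below abc -/

/-- `PolyDegree → A`: a prime factor of `deg` is at most `deg` (`deg > 0`). So A is a NECESSARY condition of
the polynomial degree conjecture; crux B asks for the converse. -/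
theorem degreePrimesPolyBounded_of_polyDegree (h : PolyDegree) : DegreePrimesPolyBounded := by
  obtain ⟨κ, C, h⟩ := h
  refine ⟨κ, C, fun W _ _ _ hW ↦ ?_⟩
  obtain ⟨D, hD⟩ := h W hW
  refine ⟨D, fun ℓ _ hdvd ↦ le_trans ?_ hD⟩
  exact_mod_cast Nat.le_of_dvd D.deg_pos hdvd

/-- `X → PolyDegree` (`ε := 1`, exponent `3`). -/
theorem polyDegree_of_semistableDegreeConjecture (h : SemistableDegreeConjecture) : PolyDegree := by
  obtain ⟨C, hC⟩ := h 1 one_pos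
  refine ⟨2 + 1, C, fun W _ _ _ hW ↦ ?_⟩
  obtain ⟨D, hD⟩ := hC W hW
  exact ⟨D, hD⟩

/-- `X → A`: the crux is a necessary condition of the route's target (and, through
`abc ⟹ generalised Szpiro ⟹ X`, of abc itself): an unconditional refutation of A refutes the summit. -/
theorem degreePrimesPolyBounded_of_semistableDegreeConjecture (h : SemistableDegreeConjecture) :
    DegreePrimesPolyBounded :=
  degreePrimesPolyBounded_of_polyDegree (polyDegree_of_semistableDegreeConjecture h)

/-- Quantifier sanity: with `κ, C` chosen AFTER the curve the statement is trivially true as soon as a datum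
exists (take `κ = 0`, `C = deg`). The content of A is entirely in the uniformity of `κ, C`. -/
theorem allW_exists_bound (W : WeierstrassCurve ℚ) [NeZero (W.conductorNorm ℤ)]
    (D : ModularParametrizationData W (W.conductorNorm ℤ)) :
    ∃ κ C : ℝ, ∀ ℓ : ℕ, ℓ.Prime → ℓ ∣ D.modularDegree → (ℓ : ℝ) ≤ C * (W.conductorNorm ℤ : ℝ) ^ κ := by
  refine ⟨0, D.modularDegree, fun ℓ _ hdvd ↦ ?_⟩
  rw [Real.rpow_zero, mul_one]
  exact_mod_cast Nat.le_of_dvd D.deg_pos hdvd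

/-! ## §2 Load-bearing hypotheses -/

/-- A with the primality of `ℓ` dropped: EVERY divisor of the degree is `≤ C N^κ`. -/
def DegreePrimesPolyBoundedWithoutPrime : Prop :=
  ∃ κ C : ℝ, ∀ (W : WeierstrassCurve ℚ) [W.IsElliptic] [W.IsGloballyMinimal] [NeZero (W.conductorNorm ℤ)],
    W.IsSemistable ℤ → ∃ D : ModularParametrizationData W (W.conductorNorm ℤ),
      ∀ ℓ : ℕ, ℓ ∣ D.modularDegree → (ℓ : ℝ) ≤ C * (W.conductorNorm ℤ : ℝ) ^ κ

/-- **`ℓ.Prime` is what makes A weaker than the polynomial degree conjecture**: without it A is EXACTLY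
`PolyDegree` (take `ℓ = deg`; conversely divisors are `≤ deg`). Informative for crux B: "A → PolyDegree" must
manufacture the multiplicities/depths, primality is the whole gap. -/
theorem withoutPrime_iff_polyDegree : DegreePrimesPolyBoundedWithoutPrime ↔ PolyDegree := by
  constructor
  · rintro ⟨κ, C, h⟩
    refine ⟨κ, C, fun W _ _ _ hW ↦ ?_⟩
    obtain ⟨D, hD⟩ := h W hW
    exact ⟨D, hD _ dvd_rfl⟩
  · rintro ⟨κ, C, h⟩
    refine ⟨κ, C, fun W _ _ _ hW ↦ ?_⟩
    obtain ⟨D, hD⟩ := h W hW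
    refine ⟨D, fun ℓ hdvd ↦ le_trans ?_ hD⟩
    exact_mod_cast Nat.le_of_dvd D.deg_pos hdvd

/-- A with semistability dropped (all elliptic curves over `ℚ`, minimal models). NOT refutable short of `¬abc`:
abc ⟹ generalised Szpiro for all `E/ℚ` ⟹ `deg φ_E ≪ N^{2+ε}` for all `E/ℚ`. Recorded only as a strengthening. -/
def DegreePrimesPolyBoundedWithoutSemistable : Prop :=
  ∃ κ C : ℝ, ∀ (W : WeierstrassCurve ℚ) [W.IsElliptic] [W.IsGloballyMinimal] [NeZero (W.conductorNorm ℤ)],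
    ∃ D : ModularParametrizationData W (W.conductorNorm ℤ),
      ∀ ℓ : ℕ, ℓ.Prime → ℓ ∣ D.modularDegree → (ℓ : ℝ) ≤ C * (W.conductorNorm ℤ : ℝ) ^ κ

/-- The semistability-free version implies A ("`IsSemistable` possibly unnecessary for truth"). -/
theorem degreePrimesPolyBounded_of_withoutSemistable (h : DegreePrimesPolyBoundedWithoutSemistable) :
    DegreePrimesPolyBounded := by
  obtain ⟨κ, C, h⟩ := h
  exact ⟨κ, C, fun W _ _ _ _ ↦ h W⟩

/-- A with `IsGloballyMinimal` dropped (any model; semistability and the conductor are intrinsic in the tree). -/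
def DegreePrimesPolyBoundedWithoutMinimal : Prop :=
  ∃ κ C : ℝ, ∀ (W : WeierstrassCurve ℚ) [W.IsElliptic] [NeZero (W.conductorNorm ℤ)],
    W.IsSemistable ℤ → ∃ D : ModularParametrizationData W (W.conductorNorm ℤ),
      ∀ ℓ : ℕ, ℓ.Prime → ℓ ∣ D.modularDegree → (ℓ : ℝ) ≤ C * (W.conductorNorm ℤ : ℝ) ^ κ

/-- A is the minimality-free version restricted to minimal models (so `IsGloballyMinimal` can only help). -/
theorem degreePrimesPolyBounded_of_withoutMinimal (h : DegreePrimesPolyBoundedWithoutMinimal) :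
    DegreePrimesPolyBounded := by
  obtain ⟨κ, C, h⟩ := h
  exact ⟨κ, C, fun W _ _ _ hW ↦ h W hW⟩

/-- **NEAR-MISS (informal proof complete; formal proof blocked).** `IsGloballyMinimal` IS load-bearing, for a
junk reason of the formalisation: for the integral non-minimal model `W_p` (`a_i ↦ p^i a_i`, `p` prime) of the
optimal semistable curve `E = 11a1` one has `N(W_p) = 11`, `W_p` semistable, and EVERY datum
`D : ModularParametrizationData W_p 11` has `p ∣ D.deg`: `IsNeronLatticeOf` forces `D.L.lattice = p⁻¹Λ_E`
(`g₂(p⁻¹Λ) = p⁴ g₂(Λ) = c₄(W_p)/12`), `D.f = f_E` (multiplicity one), and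
`φ_D = (z ↦ c z : ℂ/Λ_f → ℂ/p⁻¹Λ_E) ∘ φ_opt` has degree `m_E · [c⁻¹p⁻¹Λ_E : Λ_f] = 1 · (cp)²`
(`Λ_f = Λ_E`, Manin constant `1`: Cremona's tables / Česnavičius 2018 Thm 1.2). Taking `p > C · 11^κ` kills
every `κ, C`. Blocked in Lean on: no Eichler–Shimura (`Λ_f` a lattice, `φ_opt` of degree `m_E`), no value of any
Manin constant, no transport of data along `W_p ≅ E` (℘ homogeneity `℘_{p⁻¹Λ}(z) = p²℘_Λ(pz)` absent from
Mathlib). Tried: building a `W_p`-datum-to-`E`-datum bridge from `D.uniformize` alone — impossible, the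
uniformiser of `W_p` kills `p⁻¹Λ_E ⊋ Λ_E`, so no map with kernel `Λ_E` can be extracted from it. -/
theorem degreePrimesPolyBounded_false_without_minimal : ¬ DegreePrimesPolyBoundedWithoutMinimal := by
  sorry

/-! ## §3 Pumping the Manin constant: the `∀ D` strengthening is false -/

variable {W : WeierstrassCurve ℚ} {N : ℕ} [NeZero N] (D : ModularParametrizationData W N)

/-- The set of `Γ₀(N)`-orbits having a lift `τ` with `φ_D(τ) = P`. -/
def fib (P : (W.baseChange ℂ).toAffine.Point) : Set (Y0 N) :=
  {y | ∃ τ : ℍ, Y0.mk N τ = y ∧ D.φ τ = P}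

/-- The exceptional set of `deg_spec`, restated with `fib` and `Set.ncard` (definitionally equal). [folklore] -/
theorem finite_setOf_ncard_fib_ne : {P | (fib D P).ncard ≠ D.deg}.Finite := D.deg_spec

/-- Two points of `ℂ` have the same image in `E(ℂ)` iff they differ by a period. [folklore] -/
theorem uniformize_eq_iff (a b : ℂ) : D.uniformize a = D.uniformize b ↔ a - b ∈ D.L.lattice := by
  rw [← sub_eq_zero, ← map_sub, D.uniformize_eq_zero_iff]

/-- `(m ω₁ + n ω₂)/k ∈ Λ ↔ k ∣ m ∧ k ∣ n`. -/
theorem div_mem_lattice_iff (L : PeriodPair) (m n : ℤ) {k : ℕ} (hk : k ≠ 0) :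
    ((m : ℂ) * L.ω₁ + (n : ℂ) * L.ω₂) / (k : ℂ) ∈ L.lattice ↔ (k : ℤ) ∣ m ∧ (k : ℤ) ∣ n := by
  have hk' : (k : ℤ) ≠ 0 := by exact_mod_cast hk
  have h := @PeriodPair.mul_ω₁_add_mul_ω₂_mem_lattice L ((m : ℚ) / ((k : ℤ) : ℚ)) ((n : ℚ) / ((k : ℤ) : ℚ))
  rw [Rat.den_div_intCast_eq_one_iff _ _ hk', Rat.den_div_intCast_eq_one_iff _ _ hk'] at h
  rw [← h]
  push_cast
  ring_nf

/-- The `k²` translates `u((z₀ + i ω₁ + j ω₂)/k)`, `0 ≤ i, j < k`. -/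
def tors (z₀ : ℂ) (k : ℕ) (x : Fin k × Fin k) : (W.baseChange ℂ).toAffine.Point :=
  D.uniformize ((z₀ + ((x.1 : ℕ) : ℂ) * D.L.ω₁ + ((x.2 : ℕ) : ℂ) * D.L.ω₂) / (k : ℂ))

/-- Integer combinations of the periods uniformise to `O`. [folklore] -/
theorem uniformize_intComb (m n : ℤ) : D.uniformize ((m : ℂ) * D.L.ω₁ + (n : ℂ) * D.L.ω₂) = 0 :=
  (D.uniformize_eq_zero_iff _).mpr (PeriodPair.mem_lattice.mpr ⟨m, n, rfl⟩)

/-- Each translate is a `k`-th root of `u z₀`: `k • u((z₀ + iω₁ + jω₂)/k) = u z₀`. [folklore] -/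
theorem smul_tors (z₀ : ℂ) {k : ℕ} (hk : k ≠ 0) (x : Fin k × Fin k) :
    k • tors D z₀ k x = D.uniformize z₀ := by
  unfold tors
  rw [← map_nsmul, nsmul_eq_mul, mul_div_cancel₀ _ (Nat.cast_ne_zero.mpr hk), add_assoc, map_add]
  have := uniformize_intComb D (x.1 : ℕ) (x.2 : ℕ)
  push_cast at this
  rw [this, add_zero]

/-- The `k²` translates are pairwise distinct (`(iω₁ + jω₂)/k ∈ Λ ⇒ k ∣ i, j`). [folklore] -/
theorem tors_injective (z₀ : ℂ) {k : ℕ} (hk : k ≠ 0) : Function.Injective (tors D z₀ k) := by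
  intro x x' h
  unfold tors at h
  rw [uniformize_eq_iff] at h
  have key : (((((x.1 : ℕ) : ℤ) - ((x'.1 : ℕ) : ℤ) : ℤ) : ℂ) * D.L.ω₁
      + ((((x.2 : ℕ) : ℤ) - ((x'.2 : ℕ) : ℤ) : ℤ) : ℂ) * D.L.ω₂) / (k : ℂ) ∈ D.L.lattice := by
    convert h using 1
    push_cast
    ring
  rw [div_mem_lattice_iff _ _ _ hk] at key
  obtain ⟨h1, h2⟩ := key
  have e1 : (x'.1 : ℕ) = (x.1 : ℕ) :=
    Nat.ModEq.eq_of_lt_of_lt (Nat.modEq_iff_dvd.mpr h1) x'.1.isLt x.1.isLt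
  have e2 : (x'.2 : ℕ) = (x.2 : ℕ) :=
    Nat.ModEq.eq_of_lt_of_lt (Nat.modEq_iff_dvd.mpr h2) x'.2.isLt x.2.isLt
  exact Prod.ext (Fin.ext e1.symm) (Fin.ext e2.symm)

/-- Every `Q` with `k • Q = u z₀` is one of the `k²` translates. -/
theorem exists_tors_eq (z₀ : ℂ) {k : ℕ} (hk : k ≠ 0) {Q : (W.baseChange ℂ).toAffine.Point}
    (hQ : k • Q = D.uniformize z₀) : ∃ x, tors D z₀ k x = Q := by
  obtain ⟨w, rfl⟩ := D.uniformize_surjective Q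
  rw [← map_nsmul, nsmul_eq_mul, uniformize_eq_iff] at hQ
  obtain ⟨m, n, hmn⟩ := PeriodPair.mem_lattice.mp hQ
  have hk' : (0 : ℤ) < k := by exact_mod_cast Nat.pos_of_ne_zero hk
  have hi0 : 0 ≤ m % k := Int.emod_nonneg _ hk'.ne'
  have hj0 : 0 ≤ n % k := Int.emod_nonneg _ hk'.ne'
  have hi : (m % k).toNat < k := by
    have := Int.emod_lt_of_pos m hk'
    omega
  have hj : (n % k).toNat < k := by
    have := Int.emod_lt_of_pos n hk'
    omega
  refine ⟨(⟨(m % k).toNat, hi⟩, ⟨(n % k).toNat, hj⟩), ?_⟩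
  unfold tors
  rw [uniformize_eq_iff]
  refine PeriodPair.mem_lattice.mpr ⟨-(m / k), -(n / k), ?_⟩
  have ei : (((m % k).toNat : ℕ) : ℂ) = (m : ℂ) - (k : ℂ) * ((m / k : ℤ) : ℂ) := by
    have h1 : (((m % k).toNat : ℕ) : ℤ) = m % k := Int.toNat_of_nonneg hi0
    have h2 : m % k = m - k * (m / k) := Int.emod_def m k
    have : (((m % k).toNat : ℕ) : ℂ) = (((((m % k).toNat : ℕ) : ℤ)) : ℂ) := by push_cast; rfl
    rw [this, h1, h2]; push_cast; ring
  have ej : (((n % k).toNat : ℕ) : ℂ) = (n : ℂ) - (k : ℂ) * ((n / k : ℤ) : ℂ) := by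
    have h1 : (((n % k).toNat : ℕ) : ℤ) = n % k := Int.toNat_of_nonneg hj0
    have h2 : n % k = n - k * (n / k) := Int.emod_def n k
    have : (((n % k).toNat : ℕ) : ℂ) = (((((n % k).toNat : ℕ) : ℤ)) : ℂ) := by push_cast; rfl
    rw [this, h1, h2]; push_cast; ring
  have hkC : (k : ℂ) ≠ 0 := Nat.cast_ne_zero.mpr hk
  have hw : (k : ℂ) * w = z₀ + (m : ℂ) * D.L.ω₁ + (n : ℂ) * D.L.ω₂ := by linear_combination -hmn
  rw [ei, ej, eq_sub_iff_add_eq, eq_div_iff hkC]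
  push_cast
  linear_combination hw

/-- `{Q | k • Q = u z₀}` is exactly the range of `tors`. -/
theorem setOf_smul_eq_eq_range (z₀ : ℂ) {k : ℕ} (hk : k ≠ 0) :
    {Q : (W.baseChange ℂ).toAffine.Point | k • Q = D.uniformize z₀} = Set.range (tors D z₀ k) := by
  ext Q
  constructor
  · intro hQ
    obtain ⟨x, hx⟩ := exists_tors_eq D z₀ hk hQ
    exact ⟨x, hx⟩
  · rintro ⟨x, rfl⟩
    exact smul_tors D z₀ hk x

/-- The fibre of `k • φ` over `u z₀` is the union of the fibres of `φ` over the translates. -/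
theorem setOf_fibre_smul_eq (z₀ : ℂ) {k : ℕ} (hk : k ≠ 0) :
    {y : Y0 N | ∃ τ : ℍ, Y0.mk N τ = y ∧ k • D.φ τ = D.uniformize z₀}
      = ⋃ x : Fin k × Fin k, fib D (tors D z₀ k x) := by
  ext y
  simp only [Set.mem_setOf_eq, Set.mem_iUnion, fib]
  constructor
  · rintro ⟨τ, hy, hτ⟩
    obtain ⟨x, hx⟩ := exists_tors_eq D z₀ hk hτ
    exact ⟨x, τ, hy, hx.symm⟩
  · rintro ⟨x, τ, hy, hτ⟩
    exact ⟨τ, hy, by rw [hτ, smul_tors D z₀ hk x]⟩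

/-- Under `Γ₀(N)`-invariance of `φ`, fibres over distinct points are disjoint. -/
theorem pairwise_disjoint_fib_tors (hinv : D.φ_gamma0_smul) (z₀ : ℂ) {k : ℕ} (hk : k ≠ 0) :
    Pairwise (Function.onFun Disjoint fun x : Fin k × Fin k ↦ fib D (tors D z₀ k x)) := by
  intro x x' hne
  rw [Function.onFun, Set.disjoint_left]
  rintro y ⟨τ, hy, hτ⟩ ⟨τ', hy', hτ'⟩
  obtain ⟨γ, rfl⟩ := (Y0.mk_eq_mk_iff N τ τ').mp (hy.trans hy'.symm)
  exact hne (tors_injective D z₀ hk (hτ.symm.trans ((hinv γ τ').trans hτ')))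

/-- The fibre count of the pumped map: `k² · deg` wherever all `k²` translates are good. -/
theorem ncard_fibre_smul (hinv : D.φ_gamma0_smul) (z₀ : ℂ) {k : ℕ} (hk : k ≠ 0)
    (hgood : ∀ x : Fin k × Fin k, (fib D (tors D z₀ k x)).ncard = D.deg) :
    {y : Y0 N | ∃ τ : ℍ, Y0.mk N τ = y ∧ k • D.φ τ = D.uniformize z₀}.ncard = k ^ 2 * D.deg := by
  rw [setOf_fibre_smul_eq D z₀ hk,
    Set.ncard_iUnion_of_finite (fun x ↦ Set.finite_of_ncard_pos ((hgood x).symm ▸ D.deg_pos))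
      (pairwise_disjoint_fib_tors D hinv z₀ hk)]
  simp only [hgood]
  rw [finsum_eq_sum_of_fintype, Finset.sum_const, Finset.card_univ, Fintype.card_prod,
    Fintype.card_fin, smul_eq_mul, sq]

/-- **Pumping the Manin constant.** From a datum `D` and `k ≥ 1`: the datum with the same newform,
lattice and uniformisation, Manin constant `k c` and degree `k² deg` (`φ' = [k] ∘ φ`). The field
`deg_spec` of the new datum needs the `Γ₀(N)`-invariance of `φ_D` (`D.φ_gamma0_smul`, which holds
given the C9 fact `eichlerIntegral_gamma_smul D.f`, `φ_gamma0_smul_holds`). -/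
def pump (k : ℕ) (hk : k ≠ 0) (hinv : D.φ_gamma0_smul) : ModularParametrizationData W N where
  f := D.f
  isNewformOf := D.isNewformOf
  L := D.L
  isNeronLattice := D.isNeronLattice
  uniformize := D.uniformize
  ker_uniformize := D.ker_uniformize
  uniformize_surjective := D.uniformize_surjective
  uniformize_spec := D.uniformize_spec
  c := k * D.c
  smul_periodLattice_le z hz := by
    have h := D.smul_periodLattice_le z hz
    have : (((k : ℤ) * D.c : ℤ) : ℂ) * z = (k : ℤ) • ((D.c : ℂ) * z) := by push_cast; rw [zsmul_eq_mul]; push_cast; ring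
    rw [this]
    exact D.L.lattice.smul_mem (k : ℤ) h
  deg := k ^ 2 * D.deg
  deg_pos := Nat.mul_pos (pow_pos (Nat.pos_of_ne_zero hk) 2) D.deg_pos
  deg_spec := by
    have hbad := (finite_setOf_ncard_fib_ne D).image fun Q ↦ k • Q
    refine hbad.subset fun P hP ↦ ?_
    by_contra hP'
    apply hP
    obtain ⟨z₀, rfl⟩ := D.uniformize_surjective P
    have hgood : ∀ x : Fin k × Fin k, (fib D (tors D z₀ k x)).ncard = D.deg := by
      intro x
      by_contra hx
      exact hP' ⟨tors D z₀ k x, hx, smul_tors D z₀ hk x⟩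
    have h := ncard_fibre_smul D hinv z₀ hk hgood
    rw [← Nat.card_coe_set_eq] at h
    have e : ∀ τ : ℍ, D.uniformize ((((k : ℤ) * D.c : ℤ) : ℂ) * eichlerIntegral D.f τ) = k • D.φ τ := by
      intro τ
      show D.uniformize _ = k • D.uniformize _
      rw [← map_nsmul, nsmul_eq_mul]
      congr 1
      push_cast
      ring
    show Nat.card {y : Y0 N // ∃ τ : ℍ, Y0.mk N τ = y ∧
      D.uniformize ((((k : ℤ) * D.c : ℤ) : ℂ) * eichlerIntegral D.f τ) = D.uniformize z₀} = k ^ 2 * D.deg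
    simp_rw [e]
    exact h

/-- The pumped datum has degree `k² · deg`. [folklore] -/
theorem pump_deg (k : ℕ) (hk : k ≠ 0) (hinv : D.φ_gamma0_smul) :
    (pump D k hk hinv).modularDegree = k ^ 2 * D.modularDegree := rfl

/-- The pumped datum has Manin constant `k · c`. [folklore] -/
theorem pump_maninConstant (k : ℕ) (hk : k ≠ 0) (hinv : D.φ_gamma0_smul) :
    (pump D k hk hinv).maninConstant = k * D.maninConstant := rfl


/-- `℘` depends on the period pair only through its lattice. [folklore] -/
theorem weierstrassP_congr {L L' : PeriodPair} (h : L.lattice = L'.lattice) (z : ℂ) :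
    L.weierstrassP z = L'.weierstrassP z := by
  unfold PeriodPair.weierstrassP
  exact congrArg (fun S : Submodule ℤ ℂ ↦ ∑' l : S, (1 / (z - (l : ℂ)) ^ 2 - 1 / (l : ℂ) ^ 2)) h

/-- `℘'` depends on the period pair only through its lattice. [folklore] -/
theorem derivWeierstrassP_congr {L L' : PeriodPair} (h : L.lattice = L'.lattice) (z : ℂ) :
    L.derivWeierstrassP z = L'.derivWeierstrassP z := by
  unfold PeriodPair.derivWeierstrassP
  exact congrArg (fun S : Submodule ℤ ℂ ↦ - ∑' l : S, 2 / (z - (l : ℂ)) ^ 3) h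

/-- **The uniformisation is pinned by the lattice**: two data of the same model with the same Néron lattice
have the same `uniformize` (both vanish on `Λ` and are the `℘`-map off `Λ`). [folklore] -/
theorem uniformize_eq_of_lattice_eq (D D' : ModularParametrizationData W N) (hL : D'.L.lattice = D.L.lattice) :
    D'.uniformize = D.uniformize := by
  ext1 z
  by_cases hz : z ∈ D.L.lattice
  · rw [(D.uniformize_eq_zero_iff z).mpr hz, (D'.uniformize_eq_zero_iff z).mpr (hL ▸ hz)]
  · obtain ⟨h, e⟩ := D.uniformize_spec z hz
    obtain ⟨h', e'⟩ := D'.uniformize_spec z (hL ▸ hz)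
    rw [e, e', WeierstrassCurve.Affine.Point.some.injEq]
    simp only [weierstrassP_congr hL, derivWeierstrassP_congr hL, and_self]

/-- `E(ℂ)` is infinite: it contains `k²` distinct `k`-division points of any point, for every `k`. [folklore] -/
theorem infinite_point (D : ModularParametrizationData W N) : Infinite (W.baseChange ℂ).toAffine.Point := by
  refine Infinite.of_not_fintype fun hfin ↦ ?_
  set n := Fintype.card (W.baseChange ℂ).toAffine.Point
  have hinj := tors_injective D 0 (Nat.succ_ne_zero n)
  have := Fintype.card_le_of_injective _ hinj
  simp only [Fintype.card_prod, Fintype.card_fin] at this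
  nlinarith

/-- The degree of a datum is determined by its parametrisation: the cofinite fibre count is unique. [folklore] -/
theorem deg_unique (D : ModularParametrizationData W N) {d : ℕ}
    (hd : {P : (W.baseChange ℂ).toAffine.Point |
      Nat.card {y : Y0 N // ∃ τ : ℍ, Y0.mk N τ = y ∧ D.φ τ = P} ≠ d}.Finite) : d = D.deg := by
  by_contra hne
  haveI := infinite_point D
  have hfin : (Set.univ : Set (W.baseChange ℂ).toAffine.Point).Finite := by
    refine (hd.union D.deg_spec).subset fun P _ ↦ ?_
    by_cases hP : Nat.card {y : Y0 N // ∃ τ : ℍ, Y0.mk N τ = y ∧ D.φ τ = P} = d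
    · right
      show Nat.card {y : Y0 N // ∃ τ : ℍ, Y0.mk N τ = y ∧ D.φ τ = P} ≠ D.deg
      rw [hP]; exact hne
    · left; exact hP
  exact Set.infinite_univ hfin

/-- **Degrees scale with the square of the Manin constant.** Two data of the same model with the same newform
and the same Néron lattice whose Manin constants differ by the factor `k` have degrees differing by `k²`
(given the `Γ₀(N)`-invariance of `φ_D`). With `pump` this pins the degree set of `(W, f, Λ)` to
`{(c/g)² · d_g}` over the admissible constants `c ∈ gℤ`: the `∃ D` of the crux cannot cheat — every datum's
degree is a square multiple of the least one, so its prime support contains that of the least one. [folklore] -/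
theorem deg_eq_sq_mul_deg (D D' : ModularParametrizationData W N) (hinv : D.φ_gamma0_smul)
    (hf : D'.f = D.f) (hL : D'.L.lattice = D.L.lattice) {k : ℕ} (hk : k ≠ 0) (hc : D'.c = k * D.c) :
    D'.deg = k ^ 2 * D.deg := by
  have hu := uniformize_eq_of_lattice_eq D D' hL
  have hφ : ∀ τ, D'.φ τ = (pump D k hk hinv).φ τ := by
    intro τ
    show D'.uniformize ((D'.c : ℂ) * eichlerIntegral D'.f τ) =
      D.uniformize ((((k : ℤ) * D.c : ℤ) : ℂ) * eichlerIntegral D.f τ)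
    rw [hu, hf, hc]
  have h := (pump D k hk hinv).deg_spec
  refine (deg_unique D' (d := k ^ 2 * D.deg) ?_).symm
  convert h using 4 with P <;> first | rfl | (simp only [hφ]; rfl)


/-- The `∀ D` strengthening of A: EVERY datum (not just one) has small prime factors. -/
def DegreePrimesPolyBoundedAllD : Prop :=
  ∃ κ C : ℝ, ∀ (W : WeierstrassCurve ℚ) [W.IsElliptic] [W.IsGloballyMinimal] [NeZero (W.conductorNorm ℤ)],
    W.IsSemistable ℤ → ∀ D : ModularParametrizationData W (W.conductorNorm ℤ),
      ∀ ℓ : ℕ, ℓ.Prime → ℓ ∣ D.modularDegree → (ℓ : ℝ) ≤ C * (W.conductorNorm ℤ : ℝ) ^ κ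

/-- **The `∀ D` form is false** as soon as ONE semistable minimal curve carries ONE datum with `Γ₀(N)`-invariant
`φ`: pump its Manin constant by a prime `p > C N^κ`; then `p ∣ p² deg`. (Hypotheses dischargeable from the named
facts `nonempty_modularParametrizationData` (BCDT + Edixhoven) and `eichlerIntegral_gamma_smul` (Manin 1972),
see `not_degreePrimesPolyBoundedAllD_of_facts`.) -/
theorem not_degreePrimesPolyBoundedAllD_of (W₀ : WeierstrassCurve ℚ) [W₀.IsElliptic] [W₀.IsGloballyMinimal]
    [NeZero (W₀.conductorNorm ℤ)] (hW₀ : W₀.IsSemistable ℤ)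
    (D₀ : ModularParametrizationData W₀ (W₀.conductorNorm ℤ)) (hinv : D₀.φ_gamma0_smul) :
    ¬ DegreePrimesPolyBoundedAllD := by
  rintro ⟨κ, C, h⟩
  obtain ⟨p, hp_ge, hp⟩ := Nat.exists_infinite_primes (⌈C * (W₀.conductorNorm ℤ : ℝ) ^ κ⌉₊ + 1)
  have hle := h W₀ hW₀ (pump D₀ p hp.ne_zero hinv) p hp ⟨p * D₀.modularDegree, by rw [pump_deg]; ring⟩
  have hlt : C * (W₀.conductorNorm ℤ : ℝ) ^ κ < p :=
    calc C * (W₀.conductorNorm ℤ : ℝ) ^ κ ≤ ⌈C * (W₀.conductorNorm ℤ : ℝ) ^ κ⌉₊ := Nat.le_ceil _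
      _ < ((⌈C * (W₀.conductorNorm ℤ : ℝ) ^ κ⌉₊ + 1 : ℕ) : ℝ) := by push_cast; linarith
      _ ≤ p := by exact_mod_cast hp_ge
  linarith

/-- The same over the tree's named facts: modularity-with-integral-Manin-constant (datum existence), the
`Γ₀(N)`-invariance of Eichler integrals modulo periods, and the existence of one semistable globally-minimal
elliptic curve over `ℚ` (e.g. `y² + y = x³ − x²`, Cremona 11a3; minimality of a given equation is provable in
the tree, cf. `isGloballyMinimal_of_forall_isMinimalAt_int`, but is not needed in this generality). -/
theorem not_degreePrimesPolyBoundedAllD_of_facts (hmod : nonempty_modularParametrizationData)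
    (hES : ∀ (M : ℕ) (g : CuspForm (Gamma0 M) 2), eichlerIntegral_gamma_smul g)
    (hex : ∃ (W₀ : WeierstrassCurve ℚ) (_ : W₀.IsElliptic) (_ : W₀.IsGloballyMinimal), W₀.IsSemistable ℤ) :
    ¬ DegreePrimesPolyBoundedAllD := by
  obtain ⟨W₀, _, _, hW₀⟩ := hex
  haveI : NeZero (W₀.conductorNorm ℤ) := ⟨(WeierstrassCurve.conductorNorm_pos_holds W₀).ne'⟩
  obtain ⟨D₀⟩ := hmod W₀
  exact not_degreePrimesPolyBoundedAllD_of W₀ hW₀ D₀ (D₀.φ_gamma0_smul_holds (hES _ D₀.f))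

/-! ## §4 The only junk model: conductor `1` -/

/-- `Γ₀(1) = SL₂(ℤ)`: weight-`2` cusp forms on `Γ₀(1)` vanish (Mathlib `CuspForm.rank_eq_zero_of_weight_lt_twelve`
for `𝒮ℒ`, transported along `↑Γ₀(1) = ↑Γ(1) = 𝒮ℒ`; same proof as the sibling disprover of `FreyDegreeBound`). -/
theorem cuspForm_gamma0_one_eq_zero (f : CuspForm (Gamma0 1) 2) : f = 0 := by
  have hΓ : ((Gamma0 1 : Subgroup (Matrix.SpecialLinearGroup (Fin 2) ℤ)) : Subgroup (GL (Fin 2) ℝ)) = 𝒮ℒ := by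
    have : Gamma0 1 = CongruenceSubgroup.Gamma 1 := by
      rw [CongruenceSubgroup.Gamma_one_top]; ext A; simp [eq_iff_true_of_subsingleton]
    rw [this]; exact CongruenceSubgroup.Gamma_one_coe_eq_SL
  suffices h : ∀ Γ : Subgroup (GL (Fin 2) ℝ), Γ = 𝒮ℒ → ∀ g : CuspForm Γ 2, g = 0 from h _ hΓ f
  rintro Γ rfl g
  exact rank_zero_iff_forall_zero.mp (CuspForm.rank_eq_zero_of_weight_lt_twelve (by norm_num)) g

/-- The zero cusp form is not normalised (`a₁(0) = 0 ≠ 1`). -/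
theorem not_isNormalized_zero {Γ : Subgroup (GL (Fin 2) ℝ)} {k : ℤ} : ¬ IsNormalized (0 : CuspForm Γ k) := by
  unfold IsNormalized
  have : ((0 : CuspForm Γ k) : UpperHalfPlane → ℂ) = 0 := rfl
  rw [this, UpperHalfPlane.qExpansion_zero]
  simp

/-- No modular parametrisation datum at level `1` (its newform would be a normalised element of `S₂(Γ₀(1)) = 0`). -/
theorem isEmpty_modularParametrizationData_of_eq_one (W : WeierstrassCurve ℚ) (M : ℕ) [NeZero M] (hM : M = 1) :
    IsEmpty (ModularParametrizationData W M) := by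
  subst hM
  refine ⟨fun D ↦ ?_⟩
  have hf : D.f = 0 := cuspForm_gamma0_one_eq_zero D.f
  have hn := D.isNewformOf.1.2.2
  rw [hf] at hn
  exact not_isNormalized_zero hn

/-- **The only junk model.** If the tree's `conductorNorm ℤ` evaluated to `1` on some semistable globally-minimal
elliptic curve, A would be (junk-)false: no datum exists at level `1`. Mathematically this never happens
(`N_E ≥ 11`, Tate–Ogg: no `E/ℚ` with everywhere good reduction; for semistable `W` the tree's conductor is
`rad(Δ_min)`), but that fact is not in the tree. -/
theorem not_degreePrimesPolyBounded_of_conductorNorm_eq_one (W : WeierstrassCurve ℚ) [W.IsElliptic]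
    [W.IsGloballyMinimal] [NeZero (W.conductorNorm ℤ)] (hW : W.IsSemistable ℤ) (hN : W.conductorNorm ℤ = 1) :
    ¬ DegreePrimesPolyBounded := by
  rintro ⟨κ, C, h⟩
  obtain ⟨D, -⟩ := h W hW
  exact (isEmpty_modularParametrizationData_of_eq_one W _ hN).false D

/-! ## §5 Census (PARI `ellmoddegree`; kit jobs attached to stmt-ABC-2045 as evidence)

What a census can do here is CALIBRATE (`∃ κ C` is not finitely refutable). Two sources.

(A) The crux-ideate card `Ideas/partner-dimension-census.md` (ideator 3, kit j012368 / j012760 / j012615, full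
tables there; numbers quoted from it, not recomputed by me):
* generic semistable curves (coefficient box, 4391 classes, `N ≤ 6·10⁴`, `ellmoddegree` of the minimal model):
  `sup log P⁺(deg φ)/log N = 0.865` (N = 57923, `deg φ = 13109` prime), then 0.816, 0.800; per N-bin the max rises
  0.42 → 0.53 → 0.76 → 0.865 together with `log deg/log N` (max 0.91); `#{P⁺ > N} = 0`; `deg = 2^k·prime` in 34%;
  Dickman statistic of the odd part 0.669 (random integers: 0.624) — the largest prime factor of `deg φ` behaves
  like that of a random integer of the size of the same-level residue `δ(E)`: NO smallness structure below the
  size of `δ`.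
* Frey curves of abc hits (`c ≤ 5·10⁴`, 205 semistable): `log deg/log N` up to 1.64 but the size sits in the FREE
  level-lowering part `∏ v_p(Δ_min)`; same-level primes mostly `≤ 7`; largest 701 ≈ N^{0.77}.  High-quality
  triples (`q ≥ 1.2`, 39 semistable degrees): `log deg/log N` up to **2.01** (N = 53130), and large same-level
  primes DO occur: **17393 ≈ N^{0.891}** (N = 57435, `1 + 19140624 = 19140625`), 1013, 619, 337.
* every same-level congruence prime `ℓ ≥ 11` with `N ≤ 10³` (32/32) has its partner in the LARGEST available
  newform orbit, at a residue-degree-one prime — the route's feared enemy ("giant orbit") is the NORM, already at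
  `ℓ ≈ N^{0.4–0.5}`; what looks law-like is only `P⁺(deg φ) ≤ max(max_p v_p(Δ), P⁺(δ))` with `δ ≲ N^{1.2}`.
  Reading for this file: consistent with A for every `κ ≥ 0.9` in range; the honest structural exponent of A is
  that of `δ` itself (Masser-type semistable families force `deg φ ≥ N^{2−o(1)}`, sibling disprover of
  `FreyDegreeBound` §2), i.e. expect `κ = 2` to be needed and nothing smaller to be provable.

(B) This seat's runs (script `calib.gp` v7 in the disprover's folder: coefficient box — `elldata` is absent on
the compute node —, one CHILD `gp` per curve because `ellmoddegree` of gp 2.15.4 segfaults in-process after a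
dozen curves, precision doubling on `e_PREC`):
* j014696 (box `|a₄| ≤ 3, |a₆| ≤ 6`, squarefree `N ≤ 5000`, 411 curves, 0 failures): `sup log P⁺/log N = 0.743`
  (N = 3203, `deg φ = 401` prime), then 0.722 (N = 4499, `deg = 2·433`), 0.687 (N = 3331, `deg = 263` prime);
  histogram of `r`: 258 / 138 / 15 / 0 in `[0,¼) / [¼,½) / [½,¾) / [¾,1)`; no `P⁺ > N` — consistent with (A).
* j014711 (sample of 627 semistable curves with `6·10⁴ < N ≤ 2.5·10⁵`): ABANDONED — `ellmoddegree` needs more than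
  900 s per curve at `N ≈ 1.07·10⁵` (modular-symbol space of level `N`), so the trend of (A) (`sup r` rising
  0.42 → 0.53 → 0.76 → 0.865 per decade-ish bin) cannot be extended by computation here.  The right extension is
  Cremona's complete `degphi` tables (`N < 5·10⁵`, Watkins' analytic method): acquisition request acq-05812 filed;
  a later cycle should read `sup r` per bin from them (prediction from (A) + Dickman: `sup r → 1⁺` slowly, i.e.
  `deg φ` itself prime of size `N^{1+o(1)}` occurs; nothing approaching `κ = 2` is visible below Masser-type
  families).
-/

/-! ## §6 Index of what a prover can cite from here
* `degreePrimesPolyBounded_of_polyDegree`, `…_of_semistableDegreeConjecture` — A from anything above it.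
* `withoutPrime_iff_polyDegree` — do not try to prove A by bounding all divisors: that IS PolyDegree.
* `pump`, `pump_deg`, `pump_maninConstant` — data are not canonical; never argue about "the" datum of `W`
  without choosing the minimal one; `∀ D` statements about degrees are false (`not_degreePrimesPolyBoundedAllD_of`).
* `uniformize_eq_of_lattice_eq`, `deg_unique`, `deg_eq_sq_mul_deg`, `infinite_point` — the datum's only freedom
  is the Manin constant, and `deg ∝ c²`; useful for `ModularJacobianMultipliers` (minimal datum) and crux B.
* `not_degreePrimesPolyBounded_of_conductorNorm_eq_one` — the level-1 junk edge.
-/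

end Summit.ABC.ABC.Cruxes.DegreePrimesPolyBounded.Disproof
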